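import Summits.ABC.IUTFork.Cor312GenuineKWildDifferent
import Literature.IUT.HodgeTheaters.InitialThetaDataRootsOfUnityProofs
import HarnessLib

/-!
# [IUTchIII] Cor. 3.12, reading (P) at the ζ-negative Szpiro-bad pairs — the WILD different AT THE POLE `p = l`:
# at every fibre point `x₀ ∣ l` of the `K`-level pilot datum of a genuine Θ-volume datum of `(ratPoint q, l)` with
# `ord_l j(q) = −2t`, `l ∤ t`:  `l ∣ e(K_{x₀}/ℚ_l)` and `v(𝔇_{K_{x₀}/ℚ_l}) ≥ 2e − 1`

PROOF-ONLY support file (D-0012; 0 definitions, 0 `Prop` facts) of the abc-iut cell (ROUND 4 of the R-H rescue, census row O-18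
«reading (P) at the ζ-negative pairs»; seat abc-iut-rcat-tst-1 gen 3, KEY R4ZETA-NEG; memo `plan/rescue/R-H/ROUND4/R4-ZETA-NEG-rcat-tst-1.md`).
TAKES NO SIDE on [IUTchIII] Cor. 3.12 (S. Mochizuki, *Inter-universal Teichmüller theory III*, Cor. 3.12 p. 173–174) or on any author.

WHY. Of the 2,158 Szpiro-bad admissible (triple, l) of the cell's R-W window table exactly 30 have the typed per-image Corollary
`Cor22.ThetaVolumeDatumAt.Cor312PerImageOf` undecided by a kernel theorem (v4.54), and in ALL 30 the prime `l` divides `abc`: the Frey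
curve has multiplicative reduction AT `l`, `j(q)` has a pole at `l`. abc-iut-W-neg-1's `Cor312GenuineKWildDifferent` (p478727) typed the
WILD différent at the poles `p ∈ {3, 5}` from the `F`-rationality of the `30`-torsion ([IUTchIV] Thm. 1.10) — Tate parameter a `p`-th
power, Eisenstein radical, `v(𝔇) ≥ 2e − 1` (Serre III §6, Ore's bound attained). AT THE POLE `l` THE SAME ROUTE RUNS OFF [IUTchI]
Def. 3.1 (c) ITSELF: `K = F(E_F[l])`, so the `l`-torsion of `E_F` is `K`-rational (abc-iut-s2-p4's
`InitialThetaData.natCard_torsionBy_baseChange_eq_sq`, p469827: `#E_F(K)[l] = l²`), and over each completion `K_{x₀}`, `x₀ ∣ l`,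
Silverman ATAEC V.5.3 (the tree's `exists_tateParameter_pow_of_odd_torsion`: odd rational torsion kills the twist, no reduction
hypothesis) makes the Tate parameter `q₀ ∈ ℚ_l` of `j(q)` (`v_l(q₀) = 2t`) an `l`-th power `ρ^l` in `K_{x₀}`; with `α·2t = β·l + 1`
the element `y = ρ^α/l^β` satisfies `y^l = π`, `v_l(π) = 1`. The ladder's value at the pole `l` (rungs Z/T of abc-iut-W-num-2:
`1 − 1/(l−1)`, `1 − 1/(l·t)`) is the TAME floor; this file gives the wild `+1`.

WHAT IS PROVED (namespace `Summit.ABC.IUTFork.Conditional`, `T : Cor22.ThetaVolumeDatumAt (ratPoint q) l`, `ord_l j(q) = −2t`, `0 < t`, `l ∤ t`,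
every fibre point `x₀ ∣ l` of `pilotDataOfK T.D T.K`):
* `GenuineK.exists_finset_torsion_K` — `l²` points of `E_F(K)` killed by `l` ([IUTchI] Def. 3.1 (c) via p469827);
* `GenuineK.exists_pow_l_eq_kOf_ratPoint` — **an Eisenstein radical in `K_{x₀}`**: `∃ π ∈ ℚ_l`, `‖π‖ = l⁻¹`, `y ∈ K_{x₀}`, `y^l = π`;
* `GenuineK.l_dvd_absRamificationIdx_kOf_pole_ratPoint` (`l ∣ e(K_{x₀}/ℚ_l)`), `GenuineK.sub_one_div_le_differentOrd_kOf_pole_ratPoint`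
  (`(2e − 1)/e ≤ d(K_{x₀})`), `GenuineK.sub_one_le_multiplicity_differentIdeal_placeOf_pole_ratPoint` (`2e − 1 ≤ ord_u 𝔇_{K/ℤ}` at
  `u = placeOf x₀`) — by abc-iut-W-neg-1's `EisensteinRadicalDifferent` lemmas BY NAME;
* `GenuineK.two_sub_inv_le_differentOrd_kOf_pole_ratPoint` — the floor in the ladder's currency: **`2 − 1/l ≤ d(K_{x₀})`** (`l ∣ e`).
CONSUMER (not here): abc-iut-C-cert-1's `Cor22.ThetaVolumeDatumAt.cor312PerImageOf_of_le_floor` (LDHGenuinePerImageSufficiencyFloor) with the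
floor `B_l = 2 − 1/l` at `p = l`; desk numbers of the memo: increment `C_l·log l` ≈ 20–35 nats of log q, 25 of the 30 undecided rows positive.

HONEST FRAMING: bookkeeping over OUR typed objects (classical Tate-curve and local-field theory); nothing here bears on the printed inequality of
[IUTchIII] Cor. 3.12 or on the number-level `Cor22.Cor312AtDatum`; typed ≠ proved; instantiated ≠ endorsed; no abc claim.
[cite: Mochizuki2012, IUTchI Def. 3.1 (c) p. 62; IUTchIV Thm. 1.10 p. 22] [cite: SilvermanATAEC1994, V.5 Thm. 5.3 and Lemma V.5.1 (PDF pp. 406–409)]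
[cite: SerreLocalFields1979, Ch. III §6 Prop. 13] [cite: SilvermanAEC2009, Cor. III.6.4(b)] [claim: Mochizuki2012, status: disputed] for every IUT quotation.
-/

noncomputable section

open NumberField IsDedekindDomain

namespace Summit.ABC.IUTFork.Conditional

open Thm311 Thm311.Real Cor312 Cor312Prov Literature.IUT.LogVolume Literature.IUT.HodgeTheaters
  Literature.IUT.LogThetaLattice Literature.NumberTheory.NumberFields Literature.NumberTheory.DiophantineGeometry.GenEll
  Literature.NumberTheory.DiophantineGeometry Literature.NumberTheory.EllipticCurves
  Literature.NumberTheory.EllipticCurves.TateCurve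

/-! ## 0. Helpers -/

open scoped Classical in
/-- **`l²` points of `E_F(K)` killed by `l`** ([IUTchI] Def. 3.1 (c) `K = F(E_F[l])`: abc-iut-s2-p4's
`InitialThetaData.natCard_torsionBy_baseChange_eq_sq`, `#E_F(K)[l] = l²`). [cite: Mochizuki2012, IUTchI Def. 3.1 (c) p. 62]
[cite: SilvermanAEC2009, Cor. III.6.4(b)] [claim: Mochizuki2012, status: disputed] -/
theorem GenuineK.exists_finset_torsion_K {q : ℚ} {l : ℕ} (T : Cor22.ThetaVolumeDatumAt (ratPoint q) l) :
    letI := T.instFieldF; letI := T.instNumberFieldF; letI := T.instAlgebraF; letI := T.instFieldK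
    letI := T.instNumberFieldK; letI := T.instAlgebraK; letI := T.instFieldFbar; letI := T.instAlgebraFbar
    letI := T.instAlgebraKFbar; letI := T.instIsElliptic
    ∃ S : Finset (T.E.toAffine.baseChange T.K).Point, S.card = l ^ 2 ∧ ∀ Q ∈ S, l • Q = 0 := by
  letI := T.instFieldF; letI := T.instNumberFieldF; letI := T.instAlgebraF; letI := T.instFieldK
  letI := T.instNumberFieldK; letI := T.instAlgebraK; letI := T.instFieldFbar; letI := T.instAlgebraFbar
  letI := T.instAlgebraKFbar; letI := T.instIsElliptic
  have hcard := T.D.natCard_torsionBy_baseChange_eq_sq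
  set A : Set (T.E.toAffine.baseChange T.K).Point := {Q | l • Q = 0} with hA
  have hAeq : (AddSubgroup.torsionBy (T.E.baseChange T.K).toAffine.Point (l : ℤ) :
      Set (T.E.baseChange T.K).toAffine.Point) = A := by
    ext Q
    change Q ∈ AddSubgroup.torsionBy _ (l : ℤ) ↔ l • Q = 0
    exact AddSubgroup.torsionBy.nsmul_iff
  have hcardA : A.ncard = l ^ 2 := by
    rw [← hAeq, ← Nat.card_coe_set_eq]
    exact hcard
  have hl0 : 0 < l := lt_of_lt_of_le (by norm_num) T.D.five_le_l
  have hfin : A.Finite := Set.finite_of_ncard_ne_zero (by rw [hcardA]; positivity)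
  refine ⟨hfin.toFinset, ?_, fun Q hQ => ?_⟩
  · rw [← Set.ncard_eq_toFinset_card A hfin, hcardA]
  · exact (Set.Finite.mem_toFinset hfin).mp hQ

open scoped Classical in
/-- Push-forward of a finset of `K`-points of `E_F` killed by `n` along an `F`-algebra map `K → L` (injective on points).
[folklore] -/
private theorem exists_finset_torsion_map_of_algHom {F : Type} [Field F] (E : WeierstrassCurve F) {K L : Type} [Field K]
    [Field L] [Algebra F K] [Algebra F L] (f : K →ₐ[F] L) {n : ℕ} (S : Finset (E.toAffine.baseChange K).Point)
    (hS : ∀ Q ∈ S, n • Q = 0) :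
    ∃ S' : Finset (E.baseChange L).toAffine.Point, S'.card = S.card ∧ ∀ Q ∈ S', n • Q = 0 := by
  let ι : (E.toAffine.baseChange K).Point →+ (E.toAffine.baseChange L).Point :=
    WeierstrassCurve.Affine.Point.map f
  have hι : Function.Injective ι := WeierstrassCurve.Affine.Point.map_injective f
  refine ⟨S.map ⟨ι, hι⟩, by rw [Finset.card_map], fun Q hQ => ?_⟩
  obtain ⟨Q₀, hQ₀, rfl⟩ := Finset.mem_map.mp hQ
  show n • ι Q₀ = 0
  rw [← map_nsmul, hS Q₀ hQ₀, map_zero]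

/-- `α·k ≡ 1 (mod p)` solvably in naturals: for `k` prime to the prime `p` there are `α, β ∈ ℕ` with `α·k = β·p + 1`.
[folklore] -/
private theorem exists_mul_eq_mul_add_one' {k p : ℕ} (hp : p.Prime) (hk : ¬ p ∣ k) :
    ∃ α β : ℕ, α * k = β * p + 1 := by
  have hcop : Nat.Coprime k p := (Nat.coprime_comm.mp ((Nat.Prime.coprime_iff_not_dvd hp).mpr hk))
  obtain ⟨m, -, hm⟩ := Nat.exists_mul_mod_eq_one_of_coprime hcop hp.one_lt
  refine ⟨m, k * m / p, ?_⟩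
  have h := Nat.div_add_mod (k * m) p
  rw [hm] at h
  rw [mul_comm m k, mul_comm (k * m / p) p]
  omega

/-! ## 1. An Eisenstein radical in `K_{x₀}` at the pole `l` -/

/-- **An Eisenstein radical in `K_{x₀}` at the pole `l`**: for a genuine Θ-volume datum `T` at a RATIONAL point `(ratPoint q, l)` at
which `j(q)` has a pole at `l` of order `2t` with `l ∤ t`, and every fibre point `x₀ ∣ l` of the pilot datum: there are `π ∈ ℚ_l` with
`‖π‖ = l⁻¹` and `y ∈ K_{x₀}` with `y^l = π`. (The `l²` `K`-rational `l`-torsion points of `E_F` — [IUTchI] Def. 3.1 (c) — over `K_{x₀}` make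
the Tate parameter `q₀ ∈ ℚ_l`, `v_l(q₀) = 2t`, an `l`-th power `ρ^l` in `K_{x₀}` — Silverman ATAEC V.5.3 via the tree's
`exists_tateParameter_pow_of_odd_torsion`, `tateJ_algebraMap`, `tateParameter_unique` — and `y = ρ^α/l^β` with `α·2t = β·l + 1`.)
[cite: SilvermanATAEC1994, V.5 Thm. 5.3 and Lemma V.5.1 (PDF pp. 406–409)] [cite: Mochizuki2012, IUTchI Def. 3.1 (c) p. 62]
[claim: Mochizuki2012, status: disputed] -/
theorem GenuineK.exists_pow_l_eq_kOf_ratPoint {q : ℚ} {l : ℕ} (T : Cor22.ThetaVolumeDatumAt (ratPoint q) l)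
    (hl : l.Prime) {t : ℕ} (ht : 0 < t) (hlt : ¬ l ∣ t)
    (hpole : ∀ v : HeightOneSpectrum (𝓞 ℚ), Rat.HeightOneSpectrum.natGenerator v = l →
      Literature.IUT.LogVolume.ord ℚ v (Cor22.jInv q) = -(2 * (t : ℤ))) :
    letI := T.instFieldF; letI := T.instNumberFieldF; letI := T.instAlgebraF; letI := T.instFieldK
    letI := T.instNumberFieldK; letI := T.instAlgebraK; letI := T.instFieldFbar; letI := T.instAlgebraFbar
    letI := T.instAlgebraKFbar; letI := T.instIsElliptic
    haveI : Fact l.Prime := ⟨hl⟩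
    ∀ x₀ : (thetaIndex (pilotDataOfK T.D T.K)).Fibre (.inr ⟨l, hl⟩),
      ∃ (π : ℚ_[l]) (y : kOf (pilotDataOfK T.D T.K) l x₀),
        ‖π‖ = ((l : ℕ) : ℝ)⁻¹ ∧ y ^ l = algebraMap ℚ_[l] (kOf (pilotDataOfK T.D T.K) l x₀) π := by
  letI := T.instFieldF; letI := T.instNumberFieldF; letI := T.instAlgebraF; letI := T.instFieldK
  letI := T.instNumberFieldK; letI := T.instAlgebraK; letI := T.instFieldFbar; letI := T.instAlgebraFbar
  letI := T.instAlgebraKFbar; letI := T.instIsElliptic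
  haveI : Fact l.Prime := ⟨hl⟩
  set pp : Nat.Primes := ⟨l, hl⟩ with hppdef
  set X := pilotDataOfK T.D T.K with hXdef
  intro x₀
  set u := placeOf X pp.1 x₀ with hudef
  have hpu : ((l : ℕ) : 𝓞 T.K) ∈ u.asIdeal := natCast_mem_placeOf X pp.1 x₀
  -- the completion `K_u` and the structure maps `K → K_u`, `F → K → K_u`
  set Ku : Type := kOf X pp.1 x₀ with hKudef
  let g : T.K →+* Ku := (RescaledCompletion.of T.K pp.1 u hpu).toRingHom.comp (algebraMap T.K (u.adicCompletion T.K))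
  let f : T.F →+* Ku := g.comp (algebraMap T.F T.K)
  letI algKKu : Algebra T.K Ku := g.toAlgebra
  letI algFKu : Algebra T.F Ku := f.toAlgebra
  haveI : IsScalarTower T.F T.K Ku := IsScalarTower.of_algebraMap_eq (fun _ => rfl)
  let gₐ : T.K →ₐ[T.F] Ku := IsScalarTower.toAlgHom T.F T.K Ku
  haveI : CharZero Ku := charZero_of_injective_algebraMap (algebraMap ℚ_[l] Ku).injective
  -- the curve `E_F ⊗ K_u` and its `j`-invariant `j(q) ∈ ℚ ⊆ ℚ_l`
  haveI hEK : (T.E.baseChange Ku).IsElliptic := inferInstanceAs (T.E.map (algebraMap T.F Ku)).IsElliptic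
  set j₀ : ℚ_[l] := ((Cor22.jInv q : ℚ) : ℚ_[l]) with hj₀def
  have hjK : (T.E.baseChange Ku).j = algebraMap ℚ_[l] Ku j₀ := by
    have h1 : (T.E.baseChange Ku).j = algebraMap T.F Ku T.E.j := T.E.map_j (algebraMap T.F Ku)
    rw [h1, T.j_eq, hj₀def, map_ratCast]
    exact eq_ratCast ((algebraMap T.F Ku).comp (algebraMap (ratPoint q).F T.F)) (Cor22.jInv q)
  -- the place of `ℚ` under `u` is the pole `l`
  set v : HeightOneSpectrum (𝓞 ℚ) := finBelow (ratPoint q).F T.F (finBelow T.F T.K u) with hvdef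
  have huchar : residueChar T.K u = (l : ℕ) := residueChar_eq_of_natCast_mem pp.1 hpu
  have hvp : Rat.HeightOneSpectrum.natGenerator v = l := by
    have hchar : residueChar ℚ v = l := by
      rw [hvdef]
      change residueChar (ratPoint q).F (finBelow (ratPoint q).F T.F (finBelow T.F T.K u)) = l
      rw [residueChar_finBelow, residueChar_finBelow, huchar]
    have hmem : ((l : ℕ) : 𝓞 ℚ) ∈ v.asIdeal := by
      rw [Cor22.natCast_mem_asIdeal_iff_residueChar_eq v hl]; exact hchar
    have hdvd := (UniformABCConjecture.natCast_mem_asIdeal_iff v pp).1 hmem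
    exact (Nat.prime_dvd_prime_iff_eq (Rat.HeightOneSpectrum.prime_natGenerator v) hl).1 hdvd
  -- `|j|_l = l^{2t} > 1`
  have hordj := hpole v hvp
  have hj0 : (Cor22.jInv q : ℚ) ≠ 0 := by
    intro h0
    rw [h0, ord_zero] at hordj
    have : (0 : ℤ) < t := by exact_mod_cast ht
    omega
  have hval : padicValRat l (Cor22.jInv q) = -(2 * (t : ℤ)) := by
    rw [← hvp, ← GenuineK.ord_rat_eq_padicValRat v hj0, hordj]
  have hpR1 : (1 : ℝ) < ((l : ℕ) : ℝ) := by exact_mod_cast hl.one_lt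
  have hpR0 : (0 : ℝ) < ((l : ℕ) : ℝ) := by positivity
  have hj₀0 : j₀ ≠ 0 := by rw [hj₀def]; exact_mod_cast hj0
  have hj₀norm : ‖j₀‖ = ((l : ℕ) : ℝ) ^ (((2 * t : ℕ) : ℤ)) := by
    rw [Padic.norm_eq_zpow_neg_valuation hj₀0, hj₀def, Padic.valuation_ratCast, hval]
    congr 1
    push_cast
    ring
  have hj₀gt : 1 < ‖j₀‖ := by
    rw [hj₀norm]
    exact one_lt_zpow₀ hpR1 (by have : 0 < t := ht; omega)
  have hjKgt : 1 < ‖(T.E.baseChange Ku).j‖ := by rw [hjK, norm_algebraMap']; exact hj₀gt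
  -- `l²` `K`-rational `l`-torsion points over `K_u`, so the Tate parameter of `E_F ⊗ K_u` is an `l`-th power
  obtain ⟨S, hS, hSl⟩ := GenuineK.exists_finset_torsion_K T
  obtain ⟨S', hS', hS'l⟩ := exists_finset_torsion_map_of_algHom T.E gₐ S hSl
  have hl2 : l ≠ 2 := by have := T.D.five_le_l; omega
  have hodd : Odd l := hl.odd_of_ne_two hl2
  obtain ⟨qK, ρ, hqK0, hqK1, hqKj, -, hρ⟩ :=
    exists_tateParameter_pow_of_odd_torsion (T.E.baseChange Ku) hjKgt hodd S' hS'l (by rw [hS', hS])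
  -- the `ℚ_l`-Tate parameter `q₀` of `j(q)`, and `q_E = q₀·1` by uniqueness
  obtain ⟨q₀, ⟨hq₀0, hq₀1, hq₀j⟩, -⟩ := existsUnique_tateJ_eq_of_one_lt_norm hj₀gt
  have hq₀K : tateJ (algebraMap ℚ_[l] Ku q₀) = (T.E.baseChange Ku).j := by
    rw [tateJ_algebraMap Ku hq₀1, hq₀j, hjK]
  have hq₀K0 : algebraMap ℚ_[l] Ku q₀ ≠ 0 := (map_ne_zero _).mpr hq₀0
  have hq₀K1 : ‖algebraMap ℚ_[l] Ku q₀‖ < 1 := by rw [norm_algebraMap']; exact hq₀1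
  have hqeq : qK = algebraMap ℚ_[l] Ku q₀ :=
    tateParameter_unique (E := T.E.baseChange Ku) hqK0 hqK1 hqKj hq₀K0 hq₀K1 hq₀K
  have hq₀norm : ‖q₀‖ = ((l : ℕ) : ℝ) ^ (-(((2 * t : ℕ) : ℤ))) := by
    have h := norm_tateJ_eq hq₀1
    rw [hq₀j, hj₀norm] at h
    rw [zpow_neg, h, inv_inv]
  -- `α·2t = β·l + 1`
  have hl2t : ¬ l ∣ 2 * t := by
    intro h
    rcases (Nat.Prime.dvd_mul hl).mp h with h2 | h2
    · exact hl2 ((Nat.prime_dvd_prime_iff_eq hl Nat.prime_two).mp h2)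
    · exact hlt h2
  obtain ⟨α, β, hαβ⟩ := exists_mul_eq_mul_add_one' hl hl2t
  -- the radical `y = ρ^α / l^β`, `y^l = q₀^α / l^{βl} =: π`, `v_l(π) = α·2t − β·l = 1`
  refine ⟨q₀ ^ α / ((l : ℕ) : ℚ_[l]) ^ (β * l), ρ ^ α / ((l : ℕ) : Ku) ^ β, ?_, ?_⟩
  · have hP : ((l : ℕ) : ℝ) ≠ 0 := hpR0.ne'
    have key : ‖q₀ ^ α / ((l : ℕ) : ℚ_[l]) ^ (β * l)‖ = ((l : ℕ) : ℝ) ^ (-(1 : ℤ)) := by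
      rw [norm_div, norm_pow, norm_pow, hq₀norm, Padic.norm_p, ← zpow_natCast (((l : ℕ) : ℝ) ^ (-(((2 * t : ℕ) : ℤ)))) α,
        ← zpow_mul, inv_pow, ← zpow_natCast ((l : ℕ) : ℝ) (β * l), ← zpow_neg, ← zpow_sub₀ hP]
      congr 1
      have h := hαβ
      push_cast
      have h' : ((α : ℤ) * (2 * t) : ℤ) = β * l + 1 := by exact_mod_cast h
      linarith
    rw [key, zpow_neg, zpow_one]
  · have h1 : (ρ ^ α / ((l : ℕ) : Ku) ^ β) ^ l = (ρ ^ l) ^ α / ((l : ℕ) : Ku) ^ (β * l) := by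
      rw [div_pow, ← pow_mul, ← pow_mul, mul_comm α l, pow_mul ρ l α]
    rw [h1, hρ, hqeq, map_div₀, map_pow, map_pow, map_natCast]

/-! ## 2. Consequences: `l ∣ e`, `(2e − 1)/e ≤ d`, `2e − 1 ≤ ord_u 𝔇_{K/ℤ}`, and the floor `2 − 1/l ≤ d` -/

/-- **`l ∣ e(K_{x₀}/ℚ_l)` at every fibre point over the pole `l`** (`ord_l j(q) = −2t`, `l ∤ t`): the value group of `K_{x₀}`
contains `l^{−1/l}`. [cite: SerreLocalFields1979, Ch. III §6 Prop. 13] [cite: Mochizuki2012, IUTchI Def. 3.1 (c) p. 62]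
[claim: Mochizuki2012, status: disputed] -/
theorem GenuineK.l_dvd_absRamificationIdx_kOf_pole_ratPoint {q : ℚ} {l : ℕ} (T : Cor22.ThetaVolumeDatumAt (ratPoint q) l)
    (hl : l.Prime) {t : ℕ} (ht : 0 < t) (hlt : ¬ l ∣ t)
    (hpole : ∀ v : HeightOneSpectrum (𝓞 ℚ), Rat.HeightOneSpectrum.natGenerator v = l →
      Literature.IUT.LogVolume.ord ℚ v (Cor22.jInv q) = -(2 * (t : ℤ))) :
    letI := T.instFieldF; letI := T.instNumberFieldF; letI := T.instAlgebraF; letI := T.instFieldK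
    letI := T.instNumberFieldK; letI := T.instAlgebraK; letI := T.instFieldFbar; letI := T.instAlgebraFbar
    letI := T.instAlgebraKFbar; letI := T.instIsElliptic
    haveI : Fact l.Prime := ⟨hl⟩
    ∀ x₀ : (thetaIndex (pilotDataOfK T.D T.K)).Fibre (.inr ⟨l, hl⟩),
      l ∣ absRamificationIdx l (kOf (pilotDataOfK T.D T.K) l x₀) := by
  haveI : Fact l.Prime := ⟨hl⟩
  intro x₀
  obtain ⟨π, y, hπ, hy⟩ := GenuineK.exists_pow_l_eq_kOf_ratPoint T hl ht hlt hpole x₀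
  exact prime_dvd_absRamificationIdx_of_pow_prime_eq l hπ hy

/-- **`(2e − 1)/e ≤ d(K_{x₀})` at every fibre point over the pole `l`** (`e = e(K_{x₀}/ℚ_l)`, `d` the normalised order of the
different, `ord(l) = 1`): Ore's bound attained — one full unit above the tame floor `(e − 1)/e` used by the ladder's rungs Z/T at `l`.
[cite: SerreLocalFields1979, Ch. III §6 Prop. 13] [cite: Mochizuki2012, IUTchI Def. 3.1 (c) p. 62] [claim: Mochizuki2012, status: disputed] -/
theorem GenuineK.sub_one_div_le_differentOrd_kOf_pole_ratPoint {q : ℚ} {l : ℕ} (T : Cor22.ThetaVolumeDatumAt (ratPoint q) l)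
    (hl : l.Prime) {t : ℕ} (ht : 0 < t) (hlt : ¬ l ∣ t)
    (hpole : ∀ v : HeightOneSpectrum (𝓞 ℚ), Rat.HeightOneSpectrum.natGenerator v = l →
      Literature.IUT.LogVolume.ord ℚ v (Cor22.jInv q) = -(2 * (t : ℤ))) :
    letI := T.instFieldF; letI := T.instNumberFieldF; letI := T.instAlgebraF; letI := T.instFieldK
    letI := T.instNumberFieldK; letI := T.instAlgebraK; letI := T.instFieldFbar; letI := T.instAlgebraFbar
    letI := T.instAlgebraKFbar; letI := T.instIsElliptic
    haveI : Fact l.Prime := ⟨hl⟩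
    ∀ x₀ : (thetaIndex (pilotDataOfK T.D T.K)).Fibre (.inr ⟨l, hl⟩),
      ((2 * absRamificationIdx l (kOf (pilotDataOfK T.D T.K) l x₀) - 1 : ℕ) : ℝ) /
          (absRamificationIdx l (kOf (pilotDataOfK T.D T.K) l x₀) : ℝ) ≤
        differentOrd l (kOf (pilotDataOfK T.D T.K) l x₀) := by
  haveI : Fact l.Prime := ⟨hl⟩
  intro x₀
  obtain ⟨π, y, hπ, hy⟩ := GenuineK.exists_pow_l_eq_kOf_ratPoint T hl ht hlt hpole x₀
  exact sub_one_div_le_differentOrd_of_pow_prime_eq l hπ hy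

/-- **Global form: `2·e(u∣l) − 1 ≤ ord_u(𝔇_{K/ℤ})`** at the place `u = placeOf x₀` of `K` under the fibre point over the pole `l`
(`d(K_u) = ord_u(𝔇_{K/ℤ})/e(u|l)`, the tree's `differentOrd_rescaledCompletion`). [cite: SerreLocalFields1979, Ch. III §4 Prop. 10 and §6 Prop. 13]
[cite: Mochizuki2012, IUTchI Def. 3.1 (c) p. 62] [claim: Mochizuki2012, status: disputed] -/
theorem GenuineK.sub_one_le_multiplicity_differentIdeal_placeOf_pole_ratPoint {q : ℚ} {l : ℕ}
    (T : Cor22.ThetaVolumeDatumAt (ratPoint q) l)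
    (hl : l.Prime) {t : ℕ} (ht : 0 < t) (hlt : ¬ l ∣ t)
    (hpole : ∀ v : HeightOneSpectrum (𝓞 ℚ), Rat.HeightOneSpectrum.natGenerator v = l →
      Literature.IUT.LogVolume.ord ℚ v (Cor22.jInv q) = -(2 * (t : ℤ))) :
    letI := T.instFieldF; letI := T.instNumberFieldF; letI := T.instAlgebraF; letI := T.instFieldK
    letI := T.instNumberFieldK; letI := T.instAlgebraK; letI := T.instFieldFbar; letI := T.instAlgebraFbar
    letI := T.instAlgebraKFbar; letI := T.instIsElliptic
    haveI : Fact l.Prime := ⟨hl⟩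
    ∀ x₀ : (thetaIndex (pilotDataOfK T.D T.K)).Fibre (.inr ⟨l, hl⟩),
      2 * (placeOf (pilotDataOfK T.D T.K) l x₀).asIdeal.ramificationIdx ℤ - 1 ≤
        multiplicity (placeOf (pilotDataOfK T.D T.K) l x₀).asIdeal (differentIdeal ℤ (𝓞 T.K)) := by
  letI := T.instFieldF; letI := T.instNumberFieldF; letI := T.instAlgebraF; letI := T.instFieldK
  letI := T.instNumberFieldK; letI := T.instAlgebraK; letI := T.instFieldFbar; letI := T.instAlgebraFbar
  letI := T.instAlgebraKFbar; letI := T.instIsElliptic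
  haveI : Fact l.Prime := ⟨hl⟩
  set pp : Nat.Primes := ⟨l, hl⟩ with hppdef
  set X := pilotDataOfK T.D T.K with hXdef
  intro x₀
  set u := placeOf X pp.1 x₀ with hudef
  have hpu : ((l : ℕ) : 𝓞 T.K) ∈ u.asIdeal := natCast_mem_placeOf X pp.1 x₀
  have h := GenuineK.sub_one_div_le_differentOrd_kOf_pole_ratPoint T hl ht hlt hpole x₀
  have he : absRamificationIdx l (kOf X pp.1 x₀) = u.asIdeal.ramificationIdx ℤ := by
    rw [show absRamificationIdx l (kOf X pp.1 x₀) =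
        absRamificationIdx l (RescaledCompletion T.K pp.1 (placeOf X pp.1 x₀) hpu) from rfl,
      absRamificationIdx_rescaledCompletion]
  have hd : differentOrd l (kOf X pp.1 x₀) =
      (multiplicity u.asIdeal (differentIdeal ℤ (𝓞 T.K)) : ℝ) / (u.asIdeal.ramificationIdx ℤ : ℝ) := by
    rw [show differentOrd l (kOf X pp.1 x₀) =
        differentOrd l (RescaledCompletion T.K pp.1 (placeOf X pp.1 x₀) hpu) from rfl,
      differentOrd_rescaledCompletion]
  rw [he, hd] at h
  have he0 : (0 : ℝ) < (u.asIdeal.ramificationIdx ℤ : ℝ) := by exact_mod_cast Ideal.ramificationIdx_pos _ _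
  rw [div_le_div_iff_of_pos_right he0] at h
  exact_mod_cast h

/-- **The floor in the ladder's currency: `2 − 1/l ≤ d(K_{x₀})`** at every fibre point over the pole `l` — from `(2e − 1)/e ≤ d`
and `l ∣ e` (`e ≥ l`): the pole-`l` différent floor `B_l = 2 − 1/l`, versus the tame floors `1 − 1/(l−1)` (rung Z) / `1 − 1/(l·t)`
(rung T) of the cell's per-image rescue ladder. [cite: SerreLocalFields1979, Ch. III §6 Prop. 13] [claim: Mochizuki2012, status: disputed] -/
theorem GenuineK.two_sub_inv_le_differentOrd_kOf_pole_ratPoint {q : ℚ} {l : ℕ} (T : Cor22.ThetaVolumeDatumAt (ratPoint q) l)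
    (hl : l.Prime) {t : ℕ} (ht : 0 < t) (hlt : ¬ l ∣ t)
    (hpole : ∀ v : HeightOneSpectrum (𝓞 ℚ), Rat.HeightOneSpectrum.natGenerator v = l →
      Literature.IUT.LogVolume.ord ℚ v (Cor22.jInv q) = -(2 * (t : ℤ))) :
    letI := T.instFieldF; letI := T.instNumberFieldF; letI := T.instAlgebraF; letI := T.instFieldK
    letI := T.instNumberFieldK; letI := T.instAlgebraK; letI := T.instFieldFbar; letI := T.instAlgebraFbar
    letI := T.instAlgebraKFbar; letI := T.instIsElliptic
    haveI : Fact l.Prime := ⟨hl⟩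
    ∀ x₀ : (thetaIndex (pilotDataOfK T.D T.K)).Fibre (.inr ⟨l, hl⟩),
      (2 : ℝ) - ((l : ℕ) : ℝ)⁻¹ ≤ differentOrd l (kOf (pilotDataOfK T.D T.K) l x₀) := by
  letI := T.instFieldF; letI := T.instNumberFieldF; letI := T.instAlgebraF; letI := T.instFieldK
  letI := T.instNumberFieldK; letI := T.instAlgebraK; letI := T.instFieldFbar; letI := T.instAlgebraFbar
  letI := T.instAlgebraKFbar; letI := T.instIsElliptic
  haveI : Fact l.Prime := ⟨hl⟩
  intro x₀
  have hd := GenuineK.sub_one_div_le_differentOrd_kOf_pole_ratPoint T hl ht hlt hpole x₀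
  have hdvd := GenuineK.l_dvd_absRamificationIdx_kOf_pole_ratPoint T hl ht hlt hpole x₀
  set e : ℕ := absRamificationIdx l (kOf (pilotDataOfK T.D T.K) l x₀) with hedef
  have he0 : 0 < e := Literature.IUT.LogVolume.absRamificationIdx_pos l (kOf (pilotDataOfK T.D T.K) l x₀)
  have hle : l ≤ e := Nat.le_of_dvd he0 hdvd
  have heR : (0 : ℝ) < (e : ℝ) := by exact_mod_cast he0
  have hlR : (0 : ℝ) < ((l : ℕ) : ℝ) := by exact_mod_cast hl.pos
  have hleR : ((l : ℕ) : ℝ) ≤ (e : ℝ) := by exact_mod_cast hle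
  have h1 : (1 : ℕ) ≤ 2 * e := by omega
  have hcast : (((2 * e - 1 : ℕ) : ℝ)) = 2 * (e : ℝ) - 1 := by
    rw [Nat.cast_sub h1]; push_cast; ring
  rw [hcast] at hd
  -- `(2e − 1)/e = 2 − 1/e ≥ 2 − 1/l`
  have hdiv : (2 * (e : ℝ) - 1) / (e : ℝ) = 2 - (e : ℝ)⁻¹ := by
    field_simp
  have hinv : (e : ℝ)⁻¹ ≤ ((l : ℕ) : ℝ)⁻¹ := (inv_le_inv₀ heR hlR).mpr hleR
  rw [hdiv] at hd
  linarith

end Summit.ABC.IUTFork.Conditional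

end
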